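import Mathlib
import Literature.NumberTheory.LFunctions.KloostermanQuadraticTwist
import HarnessLib

/-!
# Bilinear forms with Kloosterman sums to ONE prime modulus and general coefficients:
# Fouvry–Kowalski–Michel 2014 (Thm 1.17 type I/II, Cor 1.13) and Kowalski–Michel–Sawin 2017 (Thms 1.1, 1.3)

Topic `NumberTheory/LFunctions` (exponential sums / correlations of trace functions). Named facts
(statements only, typed AS PRINTED, not proved here) for correlation sums of the normalised
Kloosterman sum `Kl₂(a;p) = p^{-1/2} Σ_{x y = a} e((x + y)/p) = p^{-1/2} S(1, a; p)` to ONE PRIME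
modulus `p` against GENERAL complex coefficients `α_m`, `β_n`:

* É. Fouvry, E. Kowalski, Ph. Michel, *Algebraic trace functions over the primes*, Duke Math. J.
  163 (2014) 1683–1736 [FouvryKowalskiMichel2014TracePrimes] (held text = arXiv:1211.6043, 23
  chunks; locators `pNNNN:Lnn` below are chunk files of `lit read paper:arxiv-1211.6043`):
  **Theorem 1.17** (§1.5, p0008:L6–35) — the type II bound
  `ΣΣ_{(m,p)=1} α_m β_n K(mn) ≪ ‖α‖‖β‖(MN)^{1/2}(p^{-1/4} + M^{-1/2} + p^{1/4} log^{1/2}p · N^{-1/2})`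
  and the type I bound `Σ_{(m,p)=1} α_m Σ_{n ≤ N} K(mn) ≪ (Σ|α_m|) N (p^{-1/2} + p^{1/2} log p / N)`
  for a non-exceptional isotypic trace weight `K` modulo `p`, implied constants depending only
  (polynomially) on the conductor; **Corollary 1.13** (§1.2, p0006:L18–30) — Kloosterman sums at
  prime arguments with fully quantified constants `C(η)`, `0 < η < 1/48`.
* E. Kowalski, Ph. Michel, W. Sawin, *Bilinear forms with Kloosterman sums and applications*,
  Ann. of Math. 186 (2017) 413–500 [KowalskiMichelSawin2017] (held text = arXiv:1511.01636, 44
  chunks, statements on chunk p0003): **Theorem 1.1** (general bilinear forms in `[×c]*Kl_k`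
  BELOW the Pólya–Vinogradov range: `1 ≤ M ≤ Nq^{1/4}`, `q^{1/4} < MN < q^{5/4}`, bound
  `q^ε ‖α‖₂‖β‖₂ (MN)^{1/2}(M^{-1/2} + (MN)^{-3/16} q^{11/64})`) and **Theorem 1.3** (type I:
  `1 ≤ M ≤ N²`, `N < q`, `MN < q^{3/2}`, `|α_m| ≤ 1`, bound
  `q^ε ‖α‖₁^{1/2}‖α‖₂^{1/2} M^{1/4} N (M²N⁵/q³)^{-1/12}`), implied constants depending on `k, ε`.

## The instance typed, and the general form left as a TODO

Both papers prove their bounds for the trace function `K` of an arbitrary (non-exceptional,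
geometrically isotypic, weight-0 Fourier) `ℓ`-adic sheaf of bounded conductor (FKM14), resp. for
hyper-Kloosterman sums `Kl_k` of every rank `k ≥ 2` (KMS17).  Neither `ℓ`-adic sheaves / trace
functions / conductors nor `Kl_k` for `k ≥ 3` have Mathlib or tree vocabulary, so the facts below are
the `k = 2` KLOOSTERMAN INSTANCE `K(n) = Kl₂(an;p)` — the trace function of the pulled-back
Kloosterman sheaf `[×a]*𝒦ℓ₂` (rank 2, conductor 5 [FKM14 Remark 1.4], geometrically irreducible,
hence isotypic and NOT exceptional; it is the very instance FKM14 take in their own Corollary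
1.13) — written over the tree's `Literature.NumberTheory.LFunctions.kloostermanSum`
(`KloostermanPrimePower.lean`: `S(a,b;q) = Σ_{x ∈ (ℤ/qℤ)ˣ} e((ax + bx⁻¹)/q)`), normalised here as
`kl₂ p a = S(1,a;p)/√p`.  For this FIXED sheaf family the printed dependence of the implied
constants "only (polynomially) on the conductor" (FKM14) / "only on `k` and `ε`" (KMS17) becomes an
ABSOLUTE constant resp. a constant depending on `ε` alone — exactly what is typed.  The value
`Kl₂(0;p) = −p^{-1/2}` (`kloostermanSum_one_zero`: `S(1,0;p) = −1`) agrees with the papers'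
convention (FKM14's formula `p^{-1/2}Σ_{x₁x₂ = 0} e((x₁+x₂)/p) = −p^{-1/2}`; in KMS17 Thm 1.1 every
argument `cmn` is automatically a unit since `m ≤ M < q^{3/4}` and `n ≤ q − 1`).
`-- TODO(general form): isotypic trace weights of bounded conductor (FKM14 Thms 1.5–1.17 for all
such K) and hyper-Kloosterman sums Kl_k, k ≥ 3 (KMS17) — needs ℓ-adic-sheaf vocabulary.`

## Why here (cell landau-siegel, rung F-S3 §B, registry row E-006 «E*-cross»)

The design family B-multi / B-len class (O1) («profile non-smooth at the wall `z = 1`,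
`g(1⁻) ≠ 0`») of the LANDAU–SIEGEL PROGRAMME needs, besides the band term E*-band (sign `+`), the
bulk × band CROSS term: after the reflection of Zhang's Lemma 8.1 the family sum is
`Σ*_{ψ mod p} τ(ψ̄)²ψ(a) = φ(p)·S(1,a;p) + O(√p)` — Kloosterman sums to the PRIME modulus
`p ∈ (P, P(1+𝓛⁻⁶⁸))` correlated against coefficients `a = h·m` of length `≍ Pt₀ ≥ p^{3/4+ε}`
(zhang-knife FEASIBILITY.md v1.0b §0.6; OBJECTIVE.md §3.3 row E-006: «open-in-print-adjacent;
nearest [arXiv:1211.6043 Thm 1.5/1.7, Rem 1.6], [arXiv:1511.01636]; L on paper / XL in Lean —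
a named-fact import, not a proof, is the realistic Lean form»).  This file supplies the
GENERAL-COEFFICIENT members of that nearest print (the `κ∗𝐚₁` variable of the cross term carries
general coefficients): type II / type I above the Pólya–Vinogradov range (FKM14 Thm 1.17), below it
(KMS17 Thms 1.1/1.3), and the prime-variable sum with explicit constants (FKM14 Cor 1.13).  The
companion statements with STRUCTURED coefficients (primes / Möbius / twisted divisor function:
FKM14 Thms 1.5, 1.7, 1.15, 1.16) are typed separately by seat ls-Blen-typer-2
(`TraceWeightsOverPrimes.lean`, claimed 2026-08-26T15:21Z); nothing here depends on that file.
None of these facts is an estimate FOR Zhang's cross term (different coefficient classes, an extra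
average over the prime window, Gaussian weights): they are the nearest printed technology, recorded
so that E-006 can cite decls instead of prose.  «The programme SEARCHES and TYPES; no claim about
Landau–Siegel zeros, Theorems 1–2 of arXiv:2211.02515 or a repaired Margin232 until a kernel theorem
says so.»

## Contents

* `kl₂` — the normalised Kloosterman sum `Kl₂(a;p)`; `kl₂_def`, `norm_kl₂_le_two` (Weil, PROVED
  from the tree's `norm_kloostermanSum_one_prime_le`), `typeI_trivial_bound` (PROVED: the trivial
  bound `2‖α‖₁N` that Thm 1.17 (2) improves for `N ≫ p^{1/2} log p`).
* named facts `fouvryKowalskiMichel2014_theorem117_typeII`, `…_theorem117_typeI`,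
  `fouvryKowalskiMichel2014_corollary113`, `kowalskiMichelSawin2017_theorem11`,
  `kowalskiMichelSawin2017_theorem13`.

Deliberately NOT here: FKM14 Thms 1.1, 1.5, 1.7, 1.15, 1.16 and Cors 1.11, 1.12, 1.14 (companion
file / other weights); KMS17 Remark 1.2 (1.3) (a Pólya–Vinogradov-type bound only cited there, to
[FKM2]), Thms 1.5, 1.7 (applications to twisted moments and to `λ_f ⋆ 1`); any `k ≥ 3`.

## References

* É. Fouvry, E. Kowalski, Ph. Michel, *Algebraic trace functions over the primes*, Duke Math. J.
  163 (2014), no. 9, 1683–1736; arXiv:1211.6043. Thm 1.17, Cor 1.13, Rem 1.4/1.6.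
  [FouvryKowalskiMichel2014TracePrimes]
* E. Kowalski, Ph. Michel, W. Sawin, *Bilinear forms with Kloosterman sums and applications*,
  Ann. of Math. (2) 186 (2017), 413–500; arXiv:1511.01636. Thms 1.1, 1.3, Rem 1.2/1.4.
  [KowalskiMichelSawin2017]
* A. Weil, *On some exponential sums*, PNAS 34 (1948) — in the tree as
  `weil_kloosterman_bound_prime_holds` / `norm_kloostermanSum_one_prime_le`.
-/

noncomputable section

open scoped Classical
open Finset

namespace Literature.NumberTheory.LFunctions

/-! ### The normalised Kloosterman sum `Kl₂(a;p)` -/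

/-- The **normalised Kloosterman sum** (hyper-Kloosterman sum of rank 2)
`Kl₂(a;p) = p^{-1/2} Σ_{x₁x₂ = a} e((x₁ + x₂)/p) = p^{-1/2} S(1, a; p)` (FKM14 §1, display before
Remark 1.2 with `m = 2`; KMS17 §1.1), written over the tree's `kloostermanSum`
(`S(1,a;p) = Σ_{x ∈ (ℤ/pℤ)ˣ} e((x + a x⁻¹)/p)`).  At `a = 0` both sides equal `−p^{-1/2}`
(`S(1,0;p) = −1`).  Defined for every modulus `q ≥ 1`; used here only for `q` prime.
[cite: KowalskiMichelSawin2017, §1.1 (definition of Kl_k), k = 2] -/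
def kl₂ (q : ℕ) [NeZero q] (a : ZMod q) : ℂ :=
  kloostermanSum q 1 a / ((Real.sqrt q : ℝ) : ℂ)

/-- Unfolding `kl₂`. [cite: KowalskiMichelSawin2017, §1.1 (definition of Kl_k), k = 2] -/
theorem kl₂_def (q : ℕ) [NeZero q] (a : ZMod q) :
    kl₂ q a = kloostermanSum q 1 a / ((Real.sqrt q : ℝ) : ℂ) := rfl

/-- **Weil's bound in normalised form**: `|Kl₂(a;p)| ≤ 2` for every `a ∈ ℤ/pℤ`, `p` prime
(Deligne's `|Kl_k| ≤ k` for `k = 2`; at `a = 0` the value is `−p^{-1/2}`).  PROVED from the tree's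
`norm_kloostermanSum_one_prime_le : ‖S(1,n;p)‖ ≤ 2√p`.
[cite: KowalskiMichelSawin2017, §1.1 (Deligne's bound |Kl_k(a;q)| ≤ k^{ω(q)}), k = 2, q prime] -/
theorem norm_kl₂_le_two {p : ℕ} [Fact p.Prime] (a : ZMod p) : ‖kl₂ p a‖ ≤ 2 := by
  have hp : (0 : ℝ) < Real.sqrt p :=
    Real.sqrt_pos.mpr (by exact_mod_cast (Fact.out : p.Prime).pos)
  rw [kl₂_def, norm_div, Complex.norm_real, Real.norm_eq_abs, abs_of_pos hp, div_le_iff₀ hp]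
  exact norm_kloostermanSum_one_prime_le a

/-! ### Fouvry–Kowalski–Michel 2014, Theorem 1.17 (§1.5): sums of type II and type I -/

/-- **Fouvry–Kowalski–Michel 2014, Theorem 1.17 (1) — type II sums**, Kloosterman instance.
As printed (arXiv:1211.6043 §1.5, chunk p0008:L6–27): "Let `K` be a non-exceptional trace weight
modulo `p` associated to an isotypic `ℓ`-adic sheaf `𝓕`. Let `M, N ≥ 1` be parameters, and let
`(α_m)_m`, `(β_n)_n` be sequences supported on `[M/2, 2M]` and `[N/2, 2N]` respectively. (1) We
have `ΣΣ_{m,n, (m,p)=1} α_m β_n K(mn) ≪ ‖α‖‖β‖(MN)^{1/2}(1/p^{1/4} + 1/M^{1/2} + p^{1/4}log^{1/2}p/N^{1/2})`,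
where `‖α‖² = Σ|α_m|²`, `‖β‖² = Σ|β_n|²`. … In both estimates, the implicit constants depend only,
and at most polynomially, on the conductor of `𝓕`."  Typed for `K(n) = Kl₂(an;p)`, `a ≢ 0`
(sheaf `[×a]*𝒦ℓ₂`: conductor `5`, irreducible of rank 2, hence isotypic and non-exceptional), so the
implied constant is ABSOLUTE (`∃ C` first).  Sums run over `1 ≤ m ≤ ⌊2M⌋`, `1 ≤ n ≤ ⌊2N⌋`, which
contains the supports.  Status: theorem-in-print (Kloosterman instance); general trace weights:
TODO (module docstring).  Nearest print to registry row E-006 «E*-cross» of the landau-siegel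
programme — NOT an estimate of that cross term.
[cite: FouvryKowalskiMichel2014TracePrimes, Theorem 1.17 (1)] -/
def fouvryKowalskiMichel2014_theorem117_typeII : Prop :=
  ∃ C : ℝ, 0 < C ∧
    ∀ (p : ℕ) [Fact p.Prime] (a : ZMod p), a ≠ 0 →
    ∀ (M N : ℝ), 1 ≤ M → 1 ≤ N →
    ∀ (α β : ℕ → ℂ),
      (∀ m : ℕ, α m ≠ 0 → M / 2 ≤ (m : ℝ) ∧ (m : ℝ) ≤ 2 * M) →
      (∀ n : ℕ, β n ≠ 0 → N / 2 ≤ (n : ℝ) ∧ (n : ℝ) ≤ 2 * N) →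
      ‖∑ m ∈ Icc 1 ⌊2 * M⌋₊, ∑ n ∈ Icc 1 ⌊2 * N⌋₊,
          (if m.Coprime p then α m * β n * kl₂ p (a * (m : ZMod p) * (n : ZMod p)) else 0)‖ ≤
        C * Real.sqrt (∑ m ∈ Icc 1 ⌊2 * M⌋₊, ‖α m‖ ^ 2) *
          Real.sqrt (∑ n ∈ Icc 1 ⌊2 * N⌋₊, ‖β n‖ ^ 2) * (M * N) ^ (1 / 2 : ℝ) *
          ((p : ℝ) ^ (-(1 / 4 : ℝ)) + M ^ (-(1 / 2 : ℝ)) +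
            (p : ℝ) ^ (1 / 4 : ℝ) * (Real.log p) ^ (1 / 2 : ℝ) * N ^ (-(1 / 2 : ℝ)))

/-- **Fouvry–Kowalski–Michel 2014, Theorem 1.17 (2) — type I sums**, Kloosterman instance.
As printed (arXiv:1211.6043 §1.5, chunk p0008:L28–35), same notations and hypotheses as part (1):
"(2) We have `Σ_{(m,p)=1} α_m Σ_{n ≤ N} K(mn) ≪ (Σ_m |α_m|) N (1/p^{1/2} + p^{1/2} log p/N)`.
In both estimates, the implicit constants depend only, and at most polynomially, on the conductor
of `𝓕`."  Typed for `K(n) = Kl₂(an;p)`, `a ≢ 0` (absolute constant); `α` supported on `[M/2, 2M]`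
as in the theorem's preamble (the bound does not involve `M`); inner sum over `1 ≤ n ≤ ⌊N⌋`.
Non-trivial against the trivial bound `2‖α‖₁N` (`typeI_trivial_bound`) once `N ≫ p^{1/2} log p`.
Status: theorem-in-print (Kloosterman instance).  Nearest print to E-006 «E*-cross» (smooth /
long second variable), NOT an estimate of it.
[cite: FouvryKowalskiMichel2014TracePrimes, Theorem 1.17 (2)] -/
def fouvryKowalskiMichel2014_theorem117_typeI : Prop :=
  ∃ C : ℝ, 0 < C ∧
    ∀ (p : ℕ) [Fact p.Prime] (a : ZMod p), a ≠ 0 →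
    ∀ (M N : ℝ), 1 ≤ M → 1 ≤ N →
    ∀ (α : ℕ → ℂ),
      (∀ m : ℕ, α m ≠ 0 → M / 2 ≤ (m : ℝ) ∧ (m : ℝ) ≤ 2 * M) →
      ‖∑ m ∈ Icc 1 ⌊2 * M⌋₊,
          (if m.Coprime p then α m * ∑ n ∈ Icc 1 ⌊N⌋₊, kl₂ p (a * (m : ZMod p) * (n : ZMod p))
            else 0)‖ ≤
        C * (∑ m ∈ Icc 1 ⌊2 * M⌋₊, ‖α m‖) * N *
          ((p : ℝ) ^ (-(1 / 2 : ℝ)) + (p : ℝ) ^ (1 / 2 : ℝ) * Real.log p / N)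

/-- **The trivial bound that Theorem 1.17 (2) improves** (PROVED): for every prime `p`, every
`a ∈ ℤ/pℤ`, every finitely supported `α` and every `N ≥ 0`,
`|Σ_{m, (m,p)=1} α_m Σ_{n ≤ N} Kl₂(amn;p)| ≤ 2 (Σ_m |α_m|) N`, from `|Kl₂| ≤ 2` termwise.
[cite: FouvryKowalskiMichel2014TracePrimes, §1.5 (discussion after Theorem 1.17: non-trivial range N ≫ p^{1/2} log p)] -/
theorem typeI_trivial_bound {p : ℕ} [Fact p.Prime] (a : ZMod p) (S : Finset ℕ) (α : ℕ → ℂ)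
    {N : ℝ} (hN : 0 ≤ N) :
    ‖∑ m ∈ S, (if m.Coprime p then
        α m * ∑ n ∈ Icc 1 ⌊N⌋₊, kl₂ p (a * (m : ZMod p) * (n : ZMod p)) else 0)‖ ≤
      2 * (∑ m ∈ S, ‖α m‖) * N := by
  have hinner : ∀ m : ℕ,
      ‖∑ n ∈ Icc 1 ⌊N⌋₊, kl₂ p (a * (m : ZMod p) * (n : ZMod p))‖ ≤ 2 * N := by
    intro m
    calc ‖∑ n ∈ Icc 1 ⌊N⌋₊, kl₂ p (a * (m : ZMod p) * (n : ZMod p))‖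
        ≤ ∑ n ∈ Icc 1 ⌊N⌋₊, ‖kl₂ p (a * (m : ZMod p) * (n : ZMod p))‖ := norm_sum_le _ _
      _ ≤ ∑ _n ∈ Icc 1 ⌊N⌋₊, (2 : ℝ) := sum_le_sum fun n _ => norm_kl₂_le_two _
      _ = 2 * (⌊N⌋₊ : ℝ) := by
          rw [sum_const, Nat.card_Icc, nsmul_eq_mul]; push_cast; ring
      _ ≤ 2 * N := by nlinarith [Nat.floor_le hN]
  calc ‖∑ m ∈ S, (if m.Coprime p then
          α m * ∑ n ∈ Icc 1 ⌊N⌋₊, kl₂ p (a * (m : ZMod p) * (n : ZMod p)) else 0)‖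
      ≤ ∑ m ∈ S, ‖(if m.Coprime p then
          α m * ∑ n ∈ Icc 1 ⌊N⌋₊, kl₂ p (a * (m : ZMod p) * (n : ZMod p)) else 0)‖ :=
        norm_sum_le _ _
    _ ≤ ∑ m ∈ S, ‖α m‖ * (2 * N) := by
        refine sum_le_sum fun m _ => ?_
        split_ifs with h
        · rw [norm_mul]
          exact mul_le_mul_of_nonneg_left (hinner m) (norm_nonneg _)
        · rw [norm_zero]; positivity
    _ = 2 * (∑ m ∈ S, ‖α m‖) * N := by rw [← sum_mul]; ring

/-! ### Fouvry–Kowalski–Michel 2014, Corollary 1.13 (§1.2): Kloosterman sums at prime arguments -/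

/-- **Fouvry–Kowalski–Michel 2014, Corollary 1.13**, as printed (arXiv:1211.6043 §1.2, chunk
p0006:L18–30): "For every `0 < η < 1/48` there exists `C(η)` such that for every `p`, every
`X ≥ 2` and every integer `n` coprime with `p`, one has the inequalities
`|Σ_{q < X, q prime} Kl₂(nq;p) log q| ≤ C(η) X (1 + p/X)^{1/12} p^{-η}` and
`|Σ_{q < X, q prime} Kl₂(n²q²;p) e(2nq/p) log q| ≤ C(η) X (1 + p/X)^{1/12} p^{-η}`."
(`p` prime — the modulus of the trace weights throughout the paper; `e(t) = exp(2πit)`; the prime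
variable is called `r` below.)  Fully quantified in print, typed verbatim: `q < X` is
`q ∈ range ⌈X⌉` for integers `q`.  Status: theorem-in-print.  Weight = `log` on primes — the
prime-coefficient member of the E-006 «E*-cross» nearest print (Λ-type coefficient class).
[cite: FouvryKowalskiMichel2014TracePrimes, Corollary 1.13] -/
def fouvryKowalskiMichel2014_corollary113 : Prop :=
  ∀ η : ℝ, 0 < η → η < 1 / 48 → ∃ C : ℝ,
    ∀ (p : ℕ) [Fact p.Prime] (X : ℝ), 2 ≤ X → ∀ (n : ℤ), IsCoprime n (p : ℤ) →
      ‖∑ r ∈ (range ⌈X⌉₊).filter Nat.Prime,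
          kl₂ p ((n : ZMod p) * (r : ZMod p)) * ((Real.log r : ℝ) : ℂ)‖ ≤
        C * X * (1 + (p : ℝ) / X) ^ (1 / 12 : ℝ) * (p : ℝ) ^ (-η) ∧
      ‖∑ r ∈ (range ⌈X⌉₊).filter Nat.Prime,
          kl₂ p ((n : ZMod p) ^ 2 * (r : ZMod p) ^ 2) *
            Complex.exp (2 * (Real.pi : ℂ) * Complex.I * ((2 * n * (r : ℤ) : ℤ) : ℂ) / (p : ℂ)) *
            ((Real.log r : ℝ) : ℂ)‖ ≤
        C * X * (1 + (p : ℝ) / X) ^ (1 / 12 : ℝ) * (p : ℝ) ^ (-η)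

/-! ### Kowalski–Michel–Sawin 2017, Theorems 1.1 and 1.3: below the Pólya–Vinogradov range -/

/-- **Kowalski–Michel–Sawin 2017, Theorem 1.1 (general bilinear forms)**, `k = 2` instance.
As printed (arXiv:1511.01636 §1.2, chunk p0003:L85–118): "Let `q` be a prime. Let `c` be an
integer coprime to `q`. Let `M` and `N` be real numbers such that `1 ≤ M ≤ Nq^{1/4}`,
`q^{1/4} < MN < q^{5/4}`. Let `𝒩 ⊂ [1, q−1]` be an interval of length `⌊N⌋` and let
`α = (α_m)_{m ≤ M}` and `β = (β_n)_{n ∈ 𝒩}` be sequences of complex numbers. For any `ε > 0`, we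
have `B([×c]*Kl_k, α, β) ≪ q^ε ‖α‖₂‖β‖₂ (MN)^{1/2} (M^{-1/2} + (MN)^{-3/16} q^{11/64})` where the
implied constant depend only on `k` and `ε`," with `B(K, α, β) = Σ_m Σ_n α_m β_n K(mn)` ((1.1)),
`‖·‖₂` the `ℓ²` norm.  Typed at `k = 2` (constant depends on `ε` only); the interval is
`𝒩 = {n₀, …, n₀ + ⌊N⌋ − 1}` with `1 ≤ n₀`, `n₀ + ⌊N⌋ ≤ q` (i.e. `𝒩 ⊂ [1, q−1]`); `m` runs over
`1 ≤ m ≤ ⌊M⌋`.  Non-trivial below the Pólya–Vinogradov range: for `M = N ≥ q^{11/24}` (Remark 1.2).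
Status: theorem-in-print (`k = 2`); `k ≥ 3`: TODO (module docstring).  Nearest print to E-006
«E*-cross» (general coefficients, short ranges), NOT an estimate of it; HARVEST row T-045.
[cite: KowalskiMichelSawin2017, Theorem 1.1] -/
def kowalskiMichelSawin2017_theorem11 : Prop :=
  ∀ ε : ℝ, 0 < ε → ∃ C : ℝ, 0 < C ∧
    ∀ (q : ℕ) [Fact q.Prime] (c : ℤ), IsCoprime c (q : ℤ) →
    ∀ (M N : ℝ), 1 ≤ M → M ≤ N * (q : ℝ) ^ (1 / 4 : ℝ) →
      (q : ℝ) ^ (1 / 4 : ℝ) < M * N → M * N < (q : ℝ) ^ (5 / 4 : ℝ) →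
    ∀ (n₀ : ℕ), 1 ≤ n₀ → n₀ + ⌊N⌋₊ ≤ q →
    ∀ (α β : ℕ → ℂ),
      ‖∑ m ∈ Icc 1 ⌊M⌋₊, ∑ n ∈ Ico n₀ (n₀ + ⌊N⌋₊),
          α m * β n * kl₂ q ((c : ZMod q) * (m : ZMod q) * (n : ZMod q))‖ ≤
        C * (q : ℝ) ^ ε * Real.sqrt (∑ m ∈ Icc 1 ⌊M⌋₊, ‖α m‖ ^ 2) *
          Real.sqrt (∑ n ∈ Ico n₀ (n₀ + ⌊N⌋₊), ‖β n‖ ^ 2) * (M * N) ^ (1 / 2 : ℝ) *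
          (M ^ (-(1 / 2 : ℝ)) + (M * N) ^ (-(3 / 16 : ℝ)) * (q : ℝ) ^ (11 / 64 : ℝ))

/-- **Kowalski–Michel–Sawin 2017, Theorem 1.3 (special bilinear forms, "type I")**, `k = 2`
instance.  As printed (arXiv:1511.01636 §1.2, chunk p0003:L131–151): "Let `q` be a prime number.
Let `c` be an integer coprime to `q`. Let `M, N ≥ 1` be such that `1 ≤ M ≤ N²`, `N < q`,
`MN < q^{3/2}`. Let `α = (α_m)_{m ≤ M}` be a sequence of complex numbers bounded by `1`, and let
`𝒩 ⊂ [1, q−1]` be an interval of length `⌊N⌋`. For any `ε > 0`, we have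
`B([×c]*Kl_k, α, 1_𝒩) ≪ q^ε ‖α‖₁^{1/2} ‖α‖₂^{1/2} M^{1/4} N (M²N⁵/q³)^{-1/12}`, where the implied
constant depend only on `k` and `ε`."  Typed at `k = 2` (constant depends on `ε` only); interval
`𝒩 = {n₀, …, n₀ + ⌊N⌋ − 1} ⊂ [1, q−1]`; `m` over `1 ≤ m ≤ ⌊M⌋` (for the `≤ M/q` multiples of `q`
among them `Kl₂(0;q) = −q^{-1/2}`, the papers' convention — immaterial at this precision, see the
module docstring).  Non-trivial for `M = N ≥ q^{3/7}` (Remark 1.4 (1)).  Status: theorem-in-print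
(`k = 2`).  Nearest print to E-006 «E*-cross» (smooth second variable, short ranges), NOT an
estimate of it; HARVEST row T-045.
[cite: KowalskiMichelSawin2017, Theorem 1.3] -/
def kowalskiMichelSawin2017_theorem13 : Prop :=
  ∀ ε : ℝ, 0 < ε → ∃ C : ℝ, 0 < C ∧
    ∀ (q : ℕ) [Fact q.Prime] (c : ℤ), IsCoprime c (q : ℤ) →
    ∀ (M N : ℝ), 1 ≤ M → 1 ≤ N → M ≤ N ^ 2 → N < q → M * N < (q : ℝ) ^ (3 / 2 : ℝ) →
    ∀ (α : ℕ → ℂ), (∀ m : ℕ, ‖α m‖ ≤ 1) →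
    ∀ (n₀ : ℕ), 1 ≤ n₀ → n₀ + ⌊N⌋₊ ≤ q →
      ‖∑ m ∈ Icc 1 ⌊M⌋₊, α m * ∑ n ∈ Ico n₀ (n₀ + ⌊N⌋₊),
          kl₂ q ((c : ZMod q) * (m : ZMod q) * (n : ZMod q))‖ ≤
        C * (q : ℝ) ^ ε * (∑ m ∈ Icc 1 ⌊M⌋₊, ‖α m‖) ^ (1 / 2 : ℝ) *
          (Real.sqrt (∑ m ∈ Icc 1 ⌊M⌋₊, ‖α m‖ ^ 2)) ^ (1 / 2 : ℝ) * M ^ (1 / 4 : ℝ) * N *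
          (M ^ 2 * N ^ 5 / (q : ℝ) ^ 3) ^ (-(1 / 12 : ℝ))

/-! ## Appendix (2026-08-28, cell ls-idea, seat ls-idea-lens-9 `barrier`, card K-L9-1): the CORNER shape of
Theorem 1.1 — both variables incomplete (`1 ≤ M ≤ N`, `q^{1/4} < MN < q^{5/4}`), bound multiplied out — and its
one-line derivation from `kowalskiMichelSawin2017_theorem11`. -/

/-- **Kowalski–Michel–Sawin 2017, Theorem 1.1 — CORNER SHAPE (PROVED from `kowalskiMichelSawin2017_theorem11`)**
(`k = 2`; the hypothesis `M ≤ N q^{1/4}` specialised to `M ≤ N` and the bound multiplied out: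
`‖Σ_{m≤M}Σ_{n∈𝒩} α_m β_n Kl₂(cmn;q)‖ ≤ C q^ε ‖α‖₂‖β‖₂ (N^{1/2} + (MN)^{5/16} q^{11/64})` for `q` prime,
`(c,q)=1`, `1 ≤ M ≤ N`, `q^{1/4} < MN < q^{5/4}`, `𝒩 ⊂ [1,q−1]` an interval of length `⌊N⌋`, arbitrary tables).
Both variables incomplete — the shape used by cell ls-idea's `barrier` lens on the «e-corner» of the c = q layer of
U-d (seat ls-idea-lens-9, card K-L9-1, `Sketch_Lens9_KMSCorner.lean` sha16 ff83b288478e009e: hypothesis (H-compl) of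
BN-7a violated). Bookkeeping only: `(MN)^{1/2}M^{-1/2} = N^{1/2}`, `(MN)^{1/2}(MN)^{-3/16} = (MN)^{5/16}`.
[cite: KowalskiMichelSawin2017, Theorem 1.1] -/
theorem cornerTypeII_of_theorem11 (h : kowalskiMichelSawin2017_theorem11) :
    ∀ ε : ℝ, 0 < ε → ∃ C : ℝ, 0 < C ∧
        ∀ (q : ℕ) [Fact q.Prime] (c : ℤ), IsCoprime c (q : ℤ) →
        ∀ (M N : ℝ), 1 ≤ M → M ≤ N →
          (q : ℝ) ^ (1 / 4 : ℝ) < M * N → M * N < (q : ℝ) ^ (5 / 4 : ℝ) →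
        ∀ (n₀ : ℕ), 1 ≤ n₀ → n₀ + ⌊N⌋₊ ≤ q →
        ∀ (α β : ℕ → ℂ),
          ‖∑ m ∈ Icc 1 ⌊M⌋₊, ∑ n ∈ Ico n₀ (n₀ + ⌊N⌋₊),
              α m * β n * kl₂ q ((c : ZMod q) * (m : ZMod q) * (n : ZMod q))‖ ≤
            C * (q : ℝ) ^ ε * Real.sqrt (∑ m ∈ Icc 1 ⌊M⌋₊, ‖α m‖ ^ 2) *
              Real.sqrt (∑ n ∈ Ico n₀ (n₀ + ⌊N⌋₊), ‖β n‖ ^ 2) *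
              (N ^ (1 / 2 : ℝ) + (M * N) ^ (5 / 16 : ℝ) * (q : ℝ) ^ (11 / 64 : ℝ)) := by
  intro ε hε
  obtain ⟨C, hC, hmain⟩ := h ε hε
  refine ⟨C, hC, ?_⟩
  intro q _ c hc M N hM hMN hlo hhi n₀ hn₀ hn α β
  have hq1 : (1 : ℝ) ≤ (q : ℝ) := by exact_mod_cast (Fact.out : q.Prime).one_lt.le
  have hq4 : (1 : ℝ) ≤ (q : ℝ) ^ (1 / 4 : ℝ) := Real.one_le_rpow hq1 (by norm_num)
  have hMpos : 0 < M := by linarith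
  have hNpos : 0 < N := by linarith
  have hMNpos : 0 < M * N := mul_pos hMpos hNpos
  have hMN' : M ≤ N * (q : ℝ) ^ (1 / 4 : ℝ) :=
    le_trans hMN (le_mul_of_one_le_right hNpos.le hq4)
  have hb := hmain q c hc M N hM hMN' hlo hhi n₀ hn₀ hn α β
  have e1 : (M * N) ^ (1 / 2 : ℝ) * M ^ (-(1 / 2 : ℝ)) = N ^ (1 / 2 : ℝ) := by
    rw [Real.mul_rpow hMpos.le hNpos.le, Real.rpow_neg hMpos.le, mul_right_comm,
      mul_inv_cancel₀ (by positivity), one_mul]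
  have e2 : (M * N) ^ (1 / 2 : ℝ) * ((M * N) ^ (-(3 / 16 : ℝ)) * (q : ℝ) ^ (11 / 64 : ℝ)) =
      (M * N) ^ (5 / 16 : ℝ) * (q : ℝ) ^ (11 / 64 : ℝ) := by
    rw [← mul_assoc, ← Real.rpow_add hMNpos]; norm_num
  have e3 : (M * N) ^ (1 / 2 : ℝ) * (M ^ (-(1 / 2 : ℝ)) + (M * N) ^ (-(3 / 16 : ℝ)) * (q : ℝ) ^ (11 / 64 : ℝ)) =
      N ^ (1 / 2 : ℝ) + (M * N) ^ (5 / 16 : ℝ) * (q : ℝ) ^ (11 / 64 : ℝ) := by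
    rw [mul_add, e1, e2]
  calc _ ≤ _ := hb
    _ = C * (q : ℝ) ^ ε * Real.sqrt (∑ m ∈ Icc 1 ⌊M⌋₊, ‖α m‖ ^ 2) *
          Real.sqrt (∑ n ∈ Ico n₀ (n₀ + ⌊N⌋₊), ‖β n‖ ^ 2) *
          ((M * N) ^ (1 / 2 : ℝ) *
            (M ^ (-(1 / 2 : ℝ)) + (M * N) ^ (-(3 / 16 : ℝ)) * (q : ℝ) ^ (11 / 64 : ℝ))) := by ring
    _ = _ := by rw [e3]


end Literature.NumberTheory.LFunctions
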